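import Mathlib
import Literature.LinearAlgebra.Matrix.PermanentLaplace
import Summits.ValiantsHypothesis.ValiantsHypothesis.Theorems.ValuativeGCTValuativeFlipHessenbergCofactors

/-!
# The special block 1 of the size transfer: `y₁ · (cyclic shift) ⊕ [[0, y₃], [y₂, 0]]` and its bordering
# (crux `ValuativeGCT.ValuativeFlip`, stmt-ValiantsHypothesis-12624; wall-breaker axis k8 gen 1, seat 2)

Helper file (`--supports stmt-ValiantsHypothesis-12624`), line `four-row-count` (AXIS k8g1 seat 2, §1 S).  At the second
specialisation the block-1 pencil is `y₁ · C_{m+1} ⊕ A`, `A = [[0, y₃], [y₂, 0]]`, bordered by `u_A = (y₂, y₃)`,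
`v_A = (y₃, y₂)`; its permanent is `y₁^{m+1} · y₃y₂` and the permanent of its bordering is `y₁^{m+1} · (y₂³ + y₃³)`
(`sb_permanent_B1`, `sb_permanent_BB1`; permanent of a scaled permutation matrix, `2 × 2` and `3 × 3` formulas).
[this crux, line four-row-count; folklore]
-/

set_option linter.dupNamespace false
set_option maxHeartbeats 1600000

namespace Summit.ValiantsHypothesis.ValiantsHypothesis.Theorems.ValuativeFlip

open scoped BigOperators
open MvPolynomial Matrix

/-- Permanent of a `2 × 2` matrix. [folklore] -/
theorem sb_permanent_fin_two {R : Type*} [CommRing R] (A : Matrix (Fin 2) (Fin 2) R) :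
    A.permanent = A 0 0 * A 1 1 + A 0 1 * A 1 0 := by
  rw [Matrix.permanent_eq_sum_row_zero, Fin.sum_univ_two]
  simp [Fin.succAbove]

/-- Permanent of a `3 × 3` matrix. [folklore] -/
theorem sb_permanent_fin_three {R : Type*} [CommRing R] (A : Matrix (Fin 3) (Fin 3) R) : A.permanent = A 0 0 * (A 1 1 * A 2 2 + A 1 2 * A 2 1) + A 0 1 * (A 1 0 * A 2 2 + A 1 2 * A 2 0) + A 0 2 * (A 1 0 * A 2 1 + A 1 1 * A 2 0) := by
  rw [Matrix.permanent_eq_sum_row_zero, Fin.sum_univ_three, sb_permanent_fin_two, sb_permanent_fin_two, sb_permanent_fin_two]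
  simp [Fin.succAbove, Fin.lt_def]

/-- Permanent of a scalar multiple of a permutation matrix of the cyclic shift. [folklore] -/
theorem sb_permanent_cycle (m : ℕ) (c : MvPolynomial (Fin 3) ℂ) :
    (c • ((1 : Matrix (Fin (m + 1)) (Fin (m + 1)) (MvPolynomial (Fin 3) ℂ)).submatrix id ⇑(finRotate (m + 1)).symm)).permanent = c ^ (m + 1) := by
  rw [Matrix.permanent_smul, Fintype.card_fin, Matrix.permanent_permute_rows, Matrix.permanent_one, mul_one]

/-- The cyclic-shift pattern in natural coordinates is `y₁ ·` (permutation matrix of the shift). [folklore] -/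
theorem sb_cycleMatrix_eq (m : ℕ) :
    (Matrix.of fun (i j : Fin (m + 1)) => if (((j : ℕ) = (i : ℕ) + 1) ∨ ((i : ℕ) = m ∧ (j : ℕ) = 0)) then (X 0 : MvPolynomial (Fin 3) ℂ) else 0) =
    (X 0 : MvPolynomial (Fin 3) ℂ) • ((1 : Matrix (Fin (m + 1)) (Fin (m + 1)) (MvPolynomial (Fin 3) ℂ)).submatrix id ⇑(finRotate (m + 1)).symm) := by
  refine Matrix.ext fun i j => ?_
  rw [Matrix.of_apply, Matrix.smul_apply, Matrix.submatrix_apply, id, Matrix.one_apply, smul_eq_mul, mul_ite, mul_one, mul_zero]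
  have key : (((j : ℕ) = (i : ℕ) + 1) ∨ ((i : ℕ) = m ∧ (j : ℕ) = 0)) ↔ i = (finRotate (m + 1)).symm j := by
    rw [Equiv.eq_symm_apply, Fin.ext_iff, coe_finRotate]
    constructor
    · rintro (h | ⟨h1, h2⟩)
      · have hne : i ≠ Fin.last m := fun hl => by
          have := congrArg Fin.val hl; rw [Fin.val_last] at this; have := j.isLt; omega
        rw [if_neg hne]; exact h.symm
      · have hl : i = Fin.last m := Fin.ext (by rw [Fin.val_last]; exact h1)
        rw [if_pos hl]; exact h2.symm
    · intro h
      split_ifs at h with hl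
      · right; exact ⟨by rw [hl, Fin.val_last], h.symm⟩
      · left; exact h.symm
  by_cases hc : (((j : ℕ) = (i : ℕ) + 1) ∨ ((i : ℕ) = m ∧ (j : ℕ) = 0))
  · rw [if_pos hc, if_pos (key.mp hc)]
  · rw [if_neg hc, if_neg (fun h => hc (key.mpr h))]

/-- **Block form of the special block 1**: after `Fin (m+1) ⊕ Fin 2 ≃ Fin N₁`, the pencil of the special
coefficient function is `(y₁ · cyclic shift) ⊕ [[0, y₃], [y₂, 0]]`. [this crux] -/
theorem sb_B1_blockForm (t : ℕ → ℕ → Fin 3 → ℂ) (n₁ k m : ℕ) (hN : m + 1 + 2 = n₁ + k + 1)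
    (hval : ∀ (i j : ℕ) (s : Fin 3), i < n₁ + k + 1 → j < n₁ + k + 1 → t i j s = (fun (i j : ℕ) (s : Fin 3) => if (i < m + 1 ∧ j < m + 1 ∧ (j = i + 1 ∨ (i = m ∧ j = 0))) then (if s = 0 then (1 : ℂ) else 0) else if (i = m + 1 ∧ j = m + 2) then (if s = 2 then (1 : ℂ) else 0) else if (i = m + 2 ∧ j = m + 1) then (if s = 1 then (1 : ℂ) else 0) else 0) i j s) :
    ((Matrix.of fun i j : Fin (n₁ + k + 1) => (fun ij : Fin (n₁ + k + 1) × Fin (n₁ + k + 1) => ∑ s : Fin 3, (if ((ij.1 : ℕ) = (ij.2 : ℕ) ∧ n₁ + 1 ≤ (ij.1 : ℕ)) then (0 : ℂ) else t (ij.1 : ℕ) (ij.2 : ℕ) s) • (X s : MvPolynomial (Fin 3) ℂ)) (i, j))).submatrix ((finSumFinEquiv : Fin (m + 1) ⊕ Fin 2 ≃ Fin (m + 1 + 2)).trans (finCongr hN)) ((finSumFinEquiv : Fin (m + 1) ⊕ Fin 2 ≃ Fin (m + 1 + 2)).trans (finCongr hN)) = Matrix.fromBlocks (Matrix.of fun (i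 j : Fin (m + 1)) => if (((j : ℕ) = (i : ℕ) + 1) ∨ ((i : ℕ) = m ∧ (j : ℕ) = 0)) then (X 0 : MvPolynomial (Fin 3) ℂ) else 0) 0 0 (Matrix.of ![![(0 : MvPolynomial (Fin 3) ℂ), X 2], ![X 1, 0]]) := by
  have hv1 : ∀ i : Fin (m + 1), ((((finSumFinEquiv : Fin (m + 1) ⊕ Fin 2 ≃ Fin (m + 1 + 2)).trans (finCongr hN))) (Sum.inl i) : ℕ) = (i : ℕ) := fun i => by simp
  have hv2 : ∀ j : Fin 2, ((((finSumFinEquiv : Fin (m + 1) ⊕ Fin 2 ≃ Fin (m + 1 + 2)).trans (finCongr hN))) (Sum.inr j) : ℕ) = m + 1 + (j : ℕ) := fun j => by simp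
  -- the value of the special coefficient function, decided from the position of the cell
  have hspec : ∀ (a b : ℕ) (s : Fin 3), a < n₁ + k + 1 → b < n₁ + k + 1 →
      (if (a = b ∧ n₁ + 1 ≤ a) then (0 : ℂ) else t a b s) =
        if (a < m + 1 ∧ b < m + 1 ∧ (b = a + 1 ∨ (a = m ∧ b = 0))) then (if s = 0 then (1 : ℂ) else 0)
        else if (a = m + 1 ∧ b = m + 2) then (if s = 2 then (1 : ℂ) else 0)
        else if (a = m + 2 ∧ b = m + 1) then (if s = 1 then (1 : ℂ) else 0) else 0 := by
    intro a b s ha hb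
    by_cases hd : (a = b ∧ n₁ + 1 ≤ a)
    · rw [if_pos hd]
      have h1 : ¬ (a < m + 1 ∧ b < m + 1 ∧ (b = a + 1 ∨ (a = m ∧ b = 0))) := by omega
      have h2 : ¬ (a = m + 1 ∧ b = m + 2) := by omega
      have h3 : ¬ (a = m + 2 ∧ b = m + 1) := by omega
      rw [if_neg h1, if_neg h2, if_neg h3]
    · rw [if_neg hd, hval a b s ha hb]
  have hent : ∀ (a b : Fin (n₁ + k + 1)), ((Matrix.of fun i j : Fin (n₁ + k + 1) => (fun ij : Fin (n₁ + k + 1) × Fin (n₁ + k + 1) => ∑ s : Fin 3, (if ((ij.1 : ℕ) = (ij.2 : ℕ) ∧ n₁ + 1 ≤ (ij.1 : ℕ)) then (0 : ℂ) else t (ij.1 : ℕ) (ij.2 : ℕ) s) • (X s : MvPolynomial (Fin 3) ℂ)) (i, j))) a b =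
      ∑ s : Fin 3, (if ((a : ℕ) < m + 1 ∧ (b : ℕ) < m + 1 ∧ ((b : ℕ) = (a : ℕ) + 1 ∨ ((a : ℕ) = m ∧ (b : ℕ) = 0))) then (if s = 0 then (1 : ℂ) else 0)
        else if ((a : ℕ) = m + 1 ∧ (b : ℕ) = m + 2) then (if s = 2 then (1 : ℂ) else 0)
        else if ((a : ℕ) = m + 2 ∧ (b : ℕ) = m + 1) then (if s = 1 then (1 : ℂ) else 0) else 0) • (X s : MvPolynomial (Fin 3) ℂ) := by
    intro a b
    simp only [Matrix.of_apply]
    exact Finset.sum_congr rfl fun s _ => by rw [hspec a b s a.isLt b.isLt]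
  have hsum0 : (∑ s : Fin 3, (0 : ℂ) • (X s : MvPolynomial (Fin 3) ℂ)) = 0 := by simp
  have hsumX : ∀ r : Fin 3, (∑ s : Fin 3, (if s = r then (1 : ℂ) else 0) • (X s : MvPolynomial (Fin 3) ℂ)) = X r := by
    intro r; simp [Finset.sum_ite_eq']
  refine Matrix.ext fun i j => ?_
  rw [Matrix.submatrix_apply, hent]
  rcases i with i | i <;> rcases j with j | j
  · rw [hv1, hv1, Matrix.fromBlocks_apply₁₁, Matrix.of_apply]
    have hi := i.isLt; have hj := j.isLt
    by_cases hc : (((j : ℕ) = (i : ℕ) + 1) ∨ ((i : ℕ) = m ∧ (j : ℕ) = 0))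
    · have h1 : ((i : ℕ) < m + 1 ∧ (j : ℕ) < m + 1 ∧ ((j : ℕ) = (i : ℕ) + 1 ∨ ((i : ℕ) = m ∧ (j : ℕ) = 0))) := ⟨hi, hj, hc⟩
      simp only [if_pos h1, if_pos hc, hsumX]
    · have h1 : ¬ ((i : ℕ) < m + 1 ∧ (j : ℕ) < m + 1 ∧ ((j : ℕ) = (i : ℕ) + 1 ∨ ((i : ℕ) = m ∧ (j : ℕ) = 0))) := fun h => hc h.2.2
      have h2 : ¬ ((i : ℕ) = m + 1 ∧ (j : ℕ) = m + 2) := by omega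
      have h3 : ¬ ((i : ℕ) = m + 2 ∧ (j : ℕ) = m + 1) := by omega
      simp only [if_neg h1, if_neg h2, if_neg h3, if_neg hc, hsum0]
  · rw [hv1, hv2, Matrix.fromBlocks_apply₁₂, Matrix.zero_apply]
    have hi := i.isLt; have hj := j.isLt
    have h1 : ¬ ((i : ℕ) < m + 1 ∧ m + 1 + (j : ℕ) < m + 1 ∧ (m + 1 + (j : ℕ) = (i : ℕ) + 1 ∨ ((i : ℕ) = m ∧ m + 1 + (j : ℕ) = 0))) := by omega
    have h2 : ¬ ((i : ℕ) = m + 1 ∧ m + 1 + (j : ℕ) = m + 2) := by omega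
    have h3 : ¬ ((i : ℕ) = m + 2 ∧ m + 1 + (j : ℕ) = m + 1) := by omega
    simp only [if_neg h1, if_neg h2, if_neg h3, hsum0]
  · rw [hv2, hv1, Matrix.fromBlocks_apply₂₁, Matrix.zero_apply]
    have hi := i.isLt; have hj := j.isLt
    have h1 : ¬ (m + 1 + (i : ℕ) < m + 1 ∧ (j : ℕ) < m + 1 ∧ ((j : ℕ) = m + 1 + (i : ℕ) + 1 ∨ (m + 1 + (i : ℕ) = m ∧ (j : ℕ) = 0))) := by omega
    have h2 : ¬ (m + 1 + (i : ℕ) = m + 1 ∧ (j : ℕ) = m + 2) := by omega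
    have h3 : ¬ (m + 1 + (i : ℕ) = m + 2 ∧ (j : ℕ) = m + 1) := by omega
    simp only [if_neg h1, if_neg h2, if_neg h3, hsum0]
  · rw [hv2, hv2, Matrix.fromBlocks_apply₂₂]
    have hi := i.isLt; have hj := j.isLt
    have h1 : ¬ (m + 1 + (i : ℕ) < m + 1 ∧ m + 1 + (j : ℕ) < m + 1 ∧ (m + 1 + (j : ℕ) = m + 1 + (i : ℕ) + 1 ∨ (m + 1 + (i : ℕ) = m ∧ m + 1 + (j : ℕ) = 0))) := by omega
    simp only [if_neg h1]
    fin_cases i <;> fin_cases j <;> simp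

/-- **Permanent of the special block 1**: `per(y₁ C_{m+1} ⊕ [[0,y₃],[y₂,0]]) = y₁^{m+1} · (y₃ y₂)`. [this crux] -/
theorem sb_permanent_B1 (t : ℕ → ℕ → Fin 3 → ℂ) (n₁ k m : ℕ) (hN : m + 1 + 2 = n₁ + k + 1)
    (hval : ∀ (i j : ℕ) (s : Fin 3), i < n₁ + k + 1 → j < n₁ + k + 1 → t i j s = (fun (i j : ℕ) (s : Fin 3) => if (i < m + 1 ∧ j < m + 1 ∧ (j = i + 1 ∨ (i = m ∧ j = 0))) then (if s = 0 then (1 : ℂ) else 0) else if (i = m + 1 ∧ j = m + 2) then (if s = 2 then (1 : ℂ) else 0) else if (i = m + 2 ∧ j = m + 1) then (if s = 1 then (1 : ℂ) else 0) else 0) i j s) :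
    ((Matrix.of fun i j : Fin (n₁ + k + 1) => (fun ij : Fin (n₁ + k + 1) × Fin (n₁ + k + 1) => ∑ s : Fin 3, (if ((ij.1 : ℕ) = (ij.2 : ℕ) ∧ n₁ + 1 ≤ (ij.1 : ℕ)) then (0 : ℂ) else t (ij.1 : ℕ) (ij.2 : ℕ) s) • (X s : MvPolynomial (Fin 3) ℂ)) (i, j))).permanent = (X 0 : MvPolynomial (Fin 3) ℂ) ^ (m + 1) * (X 2 * X 1) := by
  rw [← Matrix.permanent_submatrix_equiv ((finSumFinEquiv : Fin (m + 1) ⊕ Fin 2 ≃ Fin (m + 1 + 2)).trans (finCongr hN)), sb_B1_blockForm t n₁ k m hN hval, sb_cycleMatrix_eq,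
    hb_permanent_fromBlocks_zero₂₁, sb_permanent_cycle, sb_permanent_fin_two]
  simp

/-- The bordered `2 × 2` block as a `3 × 3` matrix. [this crux] -/
theorem sb_BA_eq_submatrix : (Matrix.fromBlocks (Matrix.of ![![(0 : MvPolynomial (Fin 3) ℂ), X 2], ![X 1, 0]]) (Matrix.of fun (i : Fin 2) (_ : Unit) => (![(X 1 : MvPolynomial (Fin 3) ℂ), X 2] : Fin 2 → MvPolynomial (Fin 3) ℂ) i) (Matrix.of fun (_ : Unit) (j : Fin 2) => (![(X 2 : MvPolynomial (Fin 3) ℂ), X 1] : Fin 2 → MvPolynomial (Fin 3) ℂ) j) (0 : Matrix Unit Unit (MvPolynomial (Fin 3) ℂ))) = ((Matrix.of ![![(0 : MvPolynomial (Fin 3) ℂ), X 2, X 1], ![X 1, 0, X 2], ![X 2, X 1, 0]])).submatrix (((Equiv.refl (Fin 2)).sumCongr (Equiv.ofUnique Unit (Fin 1))).trans (finSumFinEquiv : Fin 2 ⊕ Fin 1 ≃ Fin 3)) (((Equiv.refl (Fin 2)).sumCongr (Equiv.ofUnique Unit (Fin 1))).trans (finSumFinEquiv : Fin 2 ⊕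 Fin 1 ≃ Fin 3)) := by
  refine Matrix.ext fun i j => ?_
  rcases i with i | i <;> rcases j with j | j
  · fin_cases i <;> fin_cases j <;> rfl
  · fin_cases i <;> rfl
  · fin_cases j <;> rfl
  · rfl

/-- Permanent of the bordered `2 × 2` block: `per [[0,y₃,y₂],[y₂,0,y₃],[y₃,y₂,0]] = y₂³ + y₃³`. [this crux] -/
theorem sb_permanent_BA : ((Matrix.fromBlocks (Matrix.of ![![(0 : MvPolynomial (Fin 3) ℂ), X 2], ![X 1, 0]]) (Matrix.of fun (i : Fin 2) (_ : Unit) => (![(X 1 : MvPolynomial (Fin 3) ℂ), X 2] : Fin 2 → MvPolynomial (Fin 3) ℂ) i) (Matrix.of fun (_ : Unit) (j : Fin 2) => (![(X 2 : MvPolynomial (Fin 3) ℂ), X 1] : Fin 2 → MvPolynomial (Fin 3) ℂ) j) (0 : Matrix Unit Unit (MvPolynomial (Fin 3) ℂ)))).permanent = (X 1 : MvPolynomial (Fin 3) ℂ) ^ 3 + X 2 ^ 3 := by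
  rw [sb_BA_eq_submatrix, Matrix.permanent_submatrix_equiv, sb_permanent_fin_three]
  simp
  ring

/-- **Block form of the bordered special block 1**: `[[y₁C ⊕ A, (0,u_A)], [(0,v_A)ᵀ, 0]]` is
`y₁C ⊕ [[A,u_A],[v_Aᵀ,0]]` after reassociating the indices. [this crux] -/
theorem sb_BB1_blockForm (t : ℕ → ℕ → Fin 3 → ℂ) (n₁ k m : ℕ) (hN : m + 1 + 2 = n₁ + k + 1)
    (hval : ∀ (i j : ℕ) (s : Fin 3), i < n₁ + k + 1 → j < n₁ + k + 1 → t i j s = (fun (i j : ℕ) (s : Fin 3) => if (i < m + 1 ∧ j < m + 1 ∧ (j = i + 1 ∨ (i = m ∧ j = 0))) then (if s = 0 then (1 : ℂ) else 0) else if (i = m + 1 ∧ j = m + 2) then (if s = 2 then (1 : ℂ) else 0) else if (i = m + 2 ∧ j = m + 1) then (if s = 1 then (1 : ℂ) else 0) else 0) i j s)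
    (hrow : ∀ (l : ℕ) (s : Fin 3), l < n₁ + k + 1 → t (n₁ + k + 1 + 3) l s = (fun (l : ℕ) (s : Fin 3) => if l = m + 1 then (if s = 2 then (1 : ℂ) else 0) else if l = m + 2 then (if s = 1 then (1 : ℂ) else 0) else 0) l s)
    (hcol : ∀ (i : ℕ) (s : Fin 3), i < n₁ + k + 1 → t i (n₁ + k + 1 + 3) s = (fun (i : ℕ) (s : Fin 3) => if i = m + 1 then (if s = 1 then (1 : ℂ) else 0) else if i = m + 2 then (if s = 2 then (1 : ℂ) else 0) else 0) i s) :
    ((Matrix.fromBlocks (Matrix.of fun i j : Fin (n₁ + k + 1) => (fun ij : Fin (n₁ + k + 1) × Fin (n₁ + k + 1) => ∑ s : Fin 3, (if ((ij.1 : ℕ) = (ij.2 : ℕ) ∧ n₁ + 1 ≤ (ij.1 : ℕ)) then (0 : ℂ) else t (ij.1 : ℕ) (ij.2 : ℕ) s) • (X s : MvPolynomial (Fin 3) ℂ)) (i, j)) (Matrix.of fun (i : Fin (n₁ + k + 1)) (_ : Unit) => (fun i : Fin (n₁ + k + 1) => ∑ s : Fin 3, t ((i : Fin (n₁ + k + 1))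 : ℕ) (n₁ + k + 1 + 3) s • (X s : MvPolynomial (Fin 3) ℂ)) i) (Matrix.of fun (_ : Unit) (j : Fin (n₁ + k + 1)) => (fun l : Fin (n₁ + k + 1) => ∑ s : Fin 3, t (n₁ + k + 1 + 3) ((l : Fin (n₁ + k + 1)) : ℕ) s • (X s : MvPolynomial (Fin 3) ℂ)) j) (0 : Matrix Unit Unit (MvPolynomial (Fin 3) ℂ)))).submatrix ((Equiv.sumAssoc (Fin (m + 1)) (Fin 2) Unit).symm.trans ((((finSumFinEquiv : Fin (m + 1) ⊕ Fin 2 ≃ Fin (m + 1 + 2)).trans (finCongr hN))).sumCongr (Equiv.refl Unit))) ((Equiv.sumAssoc (Fin (m + 1)) (Fin 2) Unit).symm.trans ((((finSumFinEquiv : Fin (m + 1) ⊕ Fin 2 ≃ Fin (m + 1 + 2)).trans (finCongr hN))).sumCongr (Equiv.refl Unit))) = Matrix.fromBlocks (Matrix.of fun (i j : Fin (m + 1)) => if (((j : ℕ) = (i : ℕ) + 1) ∨ ((i : ℕ) = m ∧ (j : ℕ) = 0)) then (X 0 : MvPolynomial (Fin 3) ℂ) else 0) 0 0 (Matrix.fromBlocks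 (Matrix.of ![![(0 : MvPolynomial (Fin 3) ℂ), X 2], ![X 1, 0]]) (Matrix.of fun (i : Fin 2) (_ : Unit) => (![(X 1 : MvPolynomial (Fin 3) ℂ), X 2] : Fin 2 → MvPolynomial (Fin 3) ℂ) i) (Matrix.of fun (_ : Unit) (j : Fin 2) => (![(X 2 : MvPolynomial (Fin 3) ℂ), X 1] : Fin 2 → MvPolynomial (Fin 3) ℂ) j) (0 : Matrix Unit Unit (MvPolynomial (Fin 3) ℂ))) := by
  have hblk := sb_B1_blockForm t n₁ k m hN hval
  have hv1 : ∀ i : Fin (m + 1), ((((finSumFinEquiv : Fin (m + 1) ⊕ Fin 2 ≃ Fin (m + 1 + 2)).trans (finCongr hN))) (Sum.inl i) : ℕ) = (i : ℕ) := fun i => by simp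
  have hv2 : ∀ j : Fin 2, ((((finSumFinEquiv : Fin (m + 1) ⊕ Fin 2 ≃ Fin (m + 1 + 2)).trans (finCongr hN))) (Sum.inr j) : ℕ) = m + 1 + (j : ℕ) := fun j => by simp
  have hsum0 : (∑ s : Fin 3, (0 : ℂ) • (X s : MvPolynomial (Fin 3) ℂ)) = 0 := by simp
  have hsumX : ∀ r : Fin 3, (∑ s : Fin 3, (if s = r then (1 : ℂ) else 0) • (X s : MvPolynomial (Fin 3) ℂ)) = X r := by
    intro r; simp [Finset.sum_ite_eq']
  have hent : ∀ (a b : Fin (m + 1) ⊕ Fin 2), ((Matrix.of fun i j : Fin (n₁ + k + 1) => (fun ij : Fin (n₁ + k + 1) × Fin (n₁ + k + 1) => ∑ s : Fin 3, (if ((ij.1 : ℕ) = (ij.2 : ℕ) ∧ n₁ + 1 ≤ (ij.1 : ℕ)) then (0 : ℂ) else t (ij.1 : ℕ) (ij.2 : ℕ) s) • (X s : MvPolynomial (Fin 3) ℂ)) (i, j))) ((((finSumFinEquiv : Fin (m + 1) ⊕ Fin 2 ≃ Fin (m + 1 + 2)).trans (finCongr hN))) a) ((((finSumFinEquiv : Fin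 (m + 1) ⊕ Fin 2 ≃ Fin (m + 1 + 2)).trans (finCongr hN))) b) =
      (Matrix.fromBlocks (Matrix.of fun (i j : Fin (m + 1)) => if (((j : ℕ) = (i : ℕ) + 1) ∨ ((i : ℕ) = m ∧ (j : ℕ) = 0)) then (X 0 : MvPolynomial (Fin 3) ℂ) else 0) 0 0 (Matrix.of ![![(0 : MvPolynomial (Fin 3) ℂ), X 2], ![X 1, 0]])) a b := fun a b =>
    congrFun (congrFun hblk a) b
  have hu : ∀ a : Fin (m + 1) ⊕ Fin 2, (fun i : Fin (n₁ + k + 1) => ∑ s : Fin 3, t ((i : Fin (n₁ + k + 1)) : ℕ) (n₁ + k + 1 + 3) s • (X s : MvPolynomial (Fin 3) ℂ)) ((((finSumFinEquiv : Fin (m + 1) ⊕ Fin 2 ≃ Fin (m + 1 + 2)).trans (finCongr hN))) a) = Sum.elim (fun _ => (0 : MvPolynomial (Fin 3) ℂ)) (![(X 1 : MvPolynomial (Fin 3) ℂ), X 2] : Fin 2 → MvPolynomial (Fin 3) ℂ) a := by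
    intro a
    rcases a with i | j
    · simp only [hv1, Sum.elim_inl]
      have hi := i.isLt
      have h0 : ∀ s : Fin 3, t (i : ℕ) (n₁ + k + 1 + 3) s = 0 := by
        intro s; rw [hcol i s (by omega)]
        have h1 : (i : ℕ) ≠ m + 1 := by omega
        have h2 : (i : ℕ) ≠ m + 2 := by omega
        simp [h1, h2]
      simp only [h0, hsum0]
    · simp only [hv2, Sum.elim_inr]
      fin_cases j
      · have h0 : ∀ s : Fin 3, t (m + 1 + 0) (n₁ + k + 1 + 3) s = if s = 1 then 1 else 0 := by
          intro s; rw [hcol _ s (by omega)]; simp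
        simp only [h0, hsumX]; simp
      · have h0 : ∀ s : Fin 3, t (m + 1 + 1) (n₁ + k + 1 + 3) s = if s = 2 then 1 else 0 := by
          intro s; rw [hcol _ s (by omega)]; simp
        simp only [h0, hsumX]; simp
  have hv : ∀ b : Fin (m + 1) ⊕ Fin 2, (fun l : Fin (n₁ + k + 1) => ∑ s : Fin 3, t (n₁ + k + 1 + 3) ((l : Fin (n₁ + k + 1)) : ℕ) s • (X s : MvPolynomial (Fin 3) ℂ)) ((((finSumFinEquiv : Fin (m + 1) ⊕ Fin 2 ≃ Fin (m + 1 + 2)).trans (finCongr hN))) b) = Sum.elim (fun _ => (0 : MvPolynomial (Fin 3) ℂ)) (![(X 2 : MvPolynomial (Fin 3) ℂ), X 1] : Fin 2 → MvPolynomial (Fin 3) ℂ) b := by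
    intro b
    rcases b with i | j
    · simp only [hv1, Sum.elim_inl]
      have hi := i.isLt
      have h0 : ∀ s : Fin 3, t (n₁ + k + 1 + 3) (i : ℕ) s = 0 := by
        intro s; rw [hrow i s (by omega)]
        have h1 : (i : ℕ) ≠ m + 1 := by omega
        have h2 : (i : ℕ) ≠ m + 2 := by omega
        simp [h1, h2]
      simp only [h0, hsum0]
    · simp only [hv2, Sum.elim_inr]
      fin_cases j
      · have h0 : ∀ s : Fin 3, t (n₁ + k + 1 + 3) (m + 1 + 0) s = if s = 2 then 1 else 0 := by
          intro s; rw [hrow _ s (by omega)]; simp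
        simp only [h0, hsumX]; simp
      · have h0 : ∀ s : Fin 3, t (n₁ + k + 1 + 3) (m + 1 + 1) s = if s = 1 then 1 else 0 := by
          intro s; rw [hrow _ s (by omega)]; simp
        simp only [h0, hsumX]; simp
  refine Matrix.ext fun i j => ?_
  rcases i with i | (i | i) <;> rcases j with j | (j | j)
  · have := hent (Sum.inl i) (Sum.inl j)
    simpa using this
  · have := hent (Sum.inl i) (Sum.inr j)
    simpa using this
  · have := hu (Sum.inl i)
    simpa using this
  · have := hent (Sum.inr i) (Sum.inl j)
    simpa using this
  · have := hent (Sum.inr i) (Sum.inr j)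
    simpa using this
  · have := hu (Sum.inr i)
    simpa using this
  · have := hv (Sum.inl j)
    simpa using this
  · have := hv (Sum.inr j)
    simpa using this
  · simp

/-- **Permanent of the bordered special block 1**: `y₁^{m+1} · (y₂³ + y₃³)`. [this crux] -/
theorem sb_permanent_BB1 (t : ℕ → ℕ → Fin 3 → ℂ) (n₁ k m : ℕ) (hN : m + 1 + 2 = n₁ + k + 1)
    (hval : ∀ (i j : ℕ) (s : Fin 3), i < n₁ + k + 1 → j < n₁ + k + 1 → t i j s = (fun (i j : ℕ) (s : Fin 3) => if (i < m + 1 ∧ j < m + 1 ∧ (j = i + 1 ∨ (i = m ∧ j = 0))) then (if s = 0 then (1 : ℂ) else 0) else if (i = m + 1 ∧ j = m + 2) then (if s = 2 then (1 : ℂ) else 0) else if (i = m + 2 ∧ j = m + 1) then (if s = 1 then (1 : ℂ) else 0) else 0) i j s)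
    (hrow : ∀ (l : ℕ) (s : Fin 3), l < n₁ + k + 1 → t (n₁ + k + 1 + 3) l s = (fun (l : ℕ) (s : Fin 3) => if l = m + 1 then (if s = 2 then (1 : ℂ) else 0) else if l = m + 2 then (if s = 1 then (1 : ℂ) else 0) else 0) l s)
    (hcol : ∀ (i : ℕ) (s : Fin 3), i < n₁ + k + 1 → t i (n₁ + k + 1 + 3) s = (fun (i : ℕ) (s : Fin 3) => if i = m + 1 then (if s = 1 then (1 : ℂ) else 0) else if i = m + 2 then (if s = 2 then (1 : ℂ) else 0) else 0) i s) :
    ((Matrix.fromBlocks (Matrix.of fun i j : Fin (n₁ + k + 1) => (fun ij : Fin (n₁ + k + 1) × Fin (n₁ + k + 1) => ∑ s : Fin 3, (if ((ij.1 : ℕ) = (ij.2 : ℕ) ∧ n₁ + 1 ≤ (ij.1 : ℕ)) then (0 : ℂ) else t (ij.1 : ℕ) (ij.2 : ℕ) s) • (X s : MvPolynomial (Fin 3) ℂ)) (i, j)) (Matrix.of fun (i : Fin (n₁ + k + 1)) (_ : Unit) => (fun i : Fin (n₁ + k + 1) => ∑ s : Fin 3, t ((i : Fin (n₁ + k + 1))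 : ℕ) (n₁ + k + 1 + 3) s • (X s : MvPolynomial (Fin 3) ℂ)) i) (Matrix.of fun (_ : Unit) (j : Fin (n₁ + k + 1)) => (fun l : Fin (n₁ + k + 1) => ∑ s : Fin 3, t (n₁ + k + 1 + 3) ((l : Fin (n₁ + k + 1)) : ℕ) s • (X s : MvPolynomial (Fin 3) ℂ)) j) (0 : Matrix Unit Unit (MvPolynomial (Fin 3) ℂ)))).permanent = (X 0 : MvPolynomial (Fin 3) ℂ) ^ (m + 1) * (X 1 ^ 3 + X 2 ^ 3) := by
  rw [← Matrix.permanent_submatrix_equiv ((Equiv.sumAssoc (Fin (m + 1)) (Fin 2) Unit).symm.trans ((((finSumFinEquiv : Fin (m + 1) ⊕ Fin 2 ≃ Fin (m + 1 + 2)).trans (finCongr hN))).sumCongr (Equiv.refl Unit))), sb_BB1_blockForm t n₁ k m hN hval hrow hcol, sb_cycleMatrix_eq,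
    hb_permanent_fromBlocks_zero₂₁, sb_permanent_cycle, sb_permanent_BA]

end Summit.ValiantsHypothesis.ValiantsHypothesis.Theorems.ValuativeFlip
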